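import Literature.ModelTheory.FiniteModelTheory.CohomologicalConsistency
import Literature.Computability.Complexity.Classes
import Literature.Computability.Complexity.GraphEncodings
import HarnessLib

/-!
# Cohomological `k`-consistency runs in polynomial time (Ó Conghaile 2022) — named fact

Source: A. Ó Conghaile, *Cohomology in Constraint Satisfaction and Structure Isomorphism*,
MFCS 2022, LIPIcs 241, 75:1–75:16 = arXiv:2206.15253 (numbering of the arXiv version): §4.2
(deciding `ℤext(𝓢, s)` is a system of `O(|A|^{2k}·|B|^k)` linear equations over `ℤ` in
`O(|A|^k·|B|^k)` unknowns, solvable in polynomial time by the algorithm of Kannan and Bachem,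
*Polynomial algorithms for computing the Smith and Hermite normal forms of an integer matrix*,
SIAM J. Comput. 8 (1979)),
§4.3.1 (the algorithm, Definition 5) and Appendix, "Proof of Proposition (prop:efficient)": for
fixed `k` the cohomological `k`-consistency algorithm decides `A →^ℤ_k B` in time polynomial in
`|A|·|B|` (at most `|A|^k·|B|^k` rounds, each testing `ℤ`-extendability of at most `|A|^k·|B|^k`
sections).

## What is vendored, and why as a fact

The statement is about running time, so it needs a machine model and an input encoding; the tree
has both only for Boolean languages (`Literature.Computability.Complexity.Classes.P`, TM2 machines)
and finite graphs (`encodingGraph`: a graph on `Fin n` as `n` paired with its `n²` adjacency bits).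
We therefore vendor the specialisation that the consumers (route PneNP/DescentTower: the level
"reject `G` unless `G →^ℤ_k K₃`" must itself be a polynomial-time refuter) can use and that the
printed proposition implies outright: for every FIXED level `k` and FIXED finite template graph `H`,
the set of codes of finite graphs `G` with `G →^ℤ_k H` (`GraphCohomologicallyKConsistent`, which is
Definition 5 for the signature of graphs, `graphCohomologicallyKConsistent_iff`) is in `P`
(polynomial in `|A|·|B|` with `|B| = |H|` constant is polynomial in `n = |G|`, and the code of `G`
has length `Θ(n²)`).  Proving it here would mean implementing the fixpoint loop and exact linear
algebra over `ℤ` (Hermite normal form with polynomially bounded intermediate entries) as a TM2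
machine with a verified polynomial clock — out of reach of a literature pass; hence a NAMED FACT
(`def … : Prop`, users take `(h : graphCohomologicalKConsistency_mem_P)`).

What is NOT here: the general finite-signature form (no Boolean encoding of finite `σ`-structures
with a template in the tree), uniformity in `k` (the degree of the polynomial grows with `k`; the
source fixes `k`), and the analogous statement for cohomological `k`-Weisfeiler–Leman (§4.3.2).
-/

namespace Literature.ModelTheory.FiniteModelTheory

open Literature.Computability.Complexity

/-- NAMED FACT (Ó Conghaile's efficiency proposition, graph/fixed-template specialisation): for
every fixed level `k` and every fixed finite template graph `H` on `Fin q`, the language of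
`encodingGraph`-codes of finite graphs `G` (on `Fin n`, all `n`) that are cohomologically
`k`-consistent with respect to `H`, `G →^ℤ_k H`, is decidable in deterministic polynomial time.
Printed form: for fixed `k`, the cohomological `k`-consistency algorithm decides `A →^ℤ_k B` for
finite structures `A, B` over a finite relational signature in time polynomial in `|A|·|B|` — the
greatest-fixpoint loop makes at most `|Hom_k(A,B)| ≤ |A|^k·|B|^k` rounds and each `ℤ`-extendability
test is solvability over `ℤ` of a linear system with at most `|A|^{2k}·|B|^k` equations in at most
`|A|^k·|B|^k` unknowns, polynomial by Kannan–Bachem (1979).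
[cite: OConghaile2022, §4.2–§4.3.1 and Appendix (proof of Prop. "efficient")] -/
def graphCohomologicalKConsistency_mem_P : Prop :=
  ∀ (k q : ℕ) (H : SimpleGraph (Fin q)),
    encodingGraph.toLanguage
        {G : Σ n, SimpleGraph (Fin n) | GraphCohomologicallyKConsistent k G.2 H} ∈ Classes.P

/-- Consequence used by refuter-domination arguments: for fixed `k` and `H`, the COMPLEMENT level
("flag `G` unless `G →^ℤ_k H`", as a language of codes: all strings that are not codes of
cohomologically `k`-consistent graphs) is in `P` as well, by closure of `P` under complement
(`compl_mem_P_iff`). [cite: OConghaile2022, §4.3.1] -/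
theorem graphCohomologicalKConsistency_compl_mem_P (h : graphCohomologicalKConsistency_mem_P)
    (k q : ℕ) (H : SimpleGraph (Fin q)) :
    (encodingGraph.toLanguage
        {G : Σ n, SimpleGraph (Fin n) | GraphCohomologicallyKConsistent k G.2 H})ᶜ ∈ Classes.P :=
  compl_mem_P_iff.2 (h k q H)

end Literature.ModelTheory.FiniteModelTheory
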